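import Literature.NumberTheory.Transcendental.IndexDescent
import HarnessLib

/-!
# A semistable proper subspace contains no non-zero algebraic Lie subalgebra

Topic: `Literature/NumberTheory/Transcendental`. Support for the closing argument of Baker's
method on `M_κ` (plan item W4 of the unit
`provefact-Literature.NumberTheory.Transcendental.H-b596640137`). An immediate but structurally
important consequence of semistability (`GaGmE.Std.Semistable`, `SemistableQuotients.lean`):
if `𝔟 ⊊ Lie M_κ` is semistable then NO non-zero connected algebraic subgroup `K` has
`Lie K ⊆ 𝔟` — the index inequality `dim 𝔟·(n - dim 𝔨) ≤ (dim 𝔟 - dim 𝔨)·n` with `𝔟 ∩ 𝔨 = 𝔨` forces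
`dim 𝔨·(n - dim 𝔟) ≤ 0`. PROVED for `ℚ̄`-data (`Semistable.finrank_eq_zero_of_le`) and, through the
index descent (`IndexDescent.Semistable.index_le`), for Philippon's `ℂ`-data
(`Semistable.finrank_eq_zero_of_le_C`). In the Philippon–Waldschmidt device restricted to
subgroups with tangent space inside `𝔟`, this leaves only `K = 0`.

## References

* A. Baker, G. Wüstholz, *Logarithmic Forms and Diophantine Geometry*, CUP 2007, §6.7.
* P. Philippon, M. Waldschmidt, *Formes linéaires de logarithmes sur les groupes algébriques
  commutatifs*, Illinois J. Math. 32 (1988), Prop. 5.12 (subgroups with `T_{G'} ⊆ W`).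
-/

noncomputable section

open Module Submodule

namespace Literature.NumberTheory.Transcendental

namespace GaGmE

namespace Std

variable {β γ δ : Type} [Fintype β] [Fintype γ] [Fintype δ] {κM : δ → γ → Kbar}

/-- The arithmetic core: `b·(n - k) ≤ (b - k)·n`, `k ≤ b < n` force `k = 0`. [folklore] -/
theorem eq_zero_of_index_le_of_lt {b k n : ℕ} (hkb : k ≤ b) (hbn : b < n)
    (h : b * (n - k) ≤ (b - k) * n) : k = 0 := by
  have hkn : k ≤ n := hkb.trans hbn.le
  zify [hkb, hkn] at h
  have h1 : (k : ℤ) * (n - b) ≤ 0 := by nlinarith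
  have h2 : (0 : ℤ) < n - b := by
    have : (b : ℤ) < n := by exact_mod_cast hbn
    linarith
  have h3 : (k : ℤ) ≤ 0 := by
    by_contra hk
    have hk' : (0 : ℤ) < k := lt_of_not_ge hk
    have := mul_pos hk' h2
    linarith
  exact_mod_cast le_antisymm h3 (by exact_mod_cast Nat.zero_le k)

/-- **No non-zero algebraic Lie subalgebra inside a semistable proper subspace** (`ℚ̄`-data).
[cite: BakerWustholz2007, §6.7 (index and semistability)] -/
theorem Semistable.finrank_eq_zero_of_le {𝔟 : Submodule ℂ (β ⊕ (γ ⊕ δ) → ℂ)} (hss : Semistable κM 𝔟)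
    (h𝔟 : 𝔟 ≠ ⊤) (D : SubgroupData β γ δ κM) (hle : D.tangent ≤ 𝔟) :
    Module.finrank ℂ D.tangent = 0 := by
  have hDtop : D.tangent ≠ ⊤ := fun h => h𝔟 (eq_top_iff.mpr (h ▸ hle))
  have hineq := hss D.tangent ⟨D, rfl⟩ hDtop
  rw [inf_eq_right.mpr hle] at hineq
  have hkb : Module.finrank ℂ D.tangent ≤ Module.finrank ℂ 𝔟 := Submodule.finrank_mono hle
  have hbn : Module.finrank ℂ 𝔟 < Fintype.card (β ⊕ (γ ⊕ δ)) := by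
    have h1 : Module.finrank ℂ 𝔟 < Module.finrank ℂ (β ⊕ (γ ⊕ δ) → ℂ) := Submodule.finrank_lt h𝔟
    simpa using h1
  exact eq_zero_of_index_le_of_lt hkb hbn hineq

/-- The same for Philippon's `ℂ`-data, for a `ℚ̄`-rational `𝔟` (index descent). [folklore] -/
theorem Semistable.finrank_eq_zero_of_le_C {𝔟 : Submodule ℂ (β ⊕ (γ ⊕ δ) → ℂ)} (hss : Semistable κM 𝔟)
    (hrat : LiePresentation.IsKRational Kbar 𝔟) (h𝔟 : 𝔟 ≠ ⊤) (K : SubgroupDataC β γ δ κM)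
    (hle : K.tangent ≤ 𝔟) : Module.finrank ℂ K.tangent = 0 := by
  have hKtop : K.tangent ≠ ⊤ := fun h => h𝔟 (eq_top_iff.mpr (h ▸ hle))
  have hineq := hss.index_le κM hrat K hKtop
  rw [inf_eq_right.mpr hle] at hineq
  have hkb : Module.finrank ℂ K.tangent ≤ Module.finrank ℂ 𝔟 := Submodule.finrank_mono hle
  have hbn : Module.finrank ℂ 𝔟 < Fintype.card (β ⊕ (γ ⊕ δ)) := by
    have h1 : Module.finrank ℂ 𝔟 < Module.finrank ℂ (β ⊕ (γ ⊕ δ) → ℂ) := Submodule.finrank_lt h𝔟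
    simpa using h1
  exact eq_zero_of_index_le_of_lt hkb hbn hineq

/-- Equivalently: the Lie algebra is zero. [folklore] -/
theorem Semistable.tangent_eq_bot_of_le_C {𝔟 : Submodule ℂ (β ⊕ (γ ⊕ δ) → ℂ)} (hss : Semistable κM 𝔟)
    (hrat : LiePresentation.IsKRational Kbar 𝔟) (h𝔟 : 𝔟 ≠ ⊤) (K : SubgroupDataC β γ δ κM)
    (hle : K.tangent ≤ 𝔟) : K.tangent = ⊥ :=
  Submodule.finrank_eq_zero.mp (hss.finrank_eq_zero_of_le_C hrat h𝔟 K hle)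

end Std

end GaGmE

end Literature.NumberTheory.Transcendental

end
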